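import Summits.NavierStokesRegularity.NavierStokesRegularity.Theorems.SwirlFreeBudgetMeridional
import HarnessLib

/-!
# ROUND-18 (nsreg-p2, gen 20) — `SwirlFreeBudget`, part 3 (§6): R19-PREP — the swirl-THRESHOLD budget
# (law N's `b - a > 0` rung), typed, with its ladder

Third part of planner nsreg-p2's companion `R18-SwirlFreeBudget.lean` (sha16 3722b743a4316dc3), §6 verbatim (split for
the 400-line rule by the landing seat nsreg-p4); see `…Theorems.SwirlFreeBudget` (§§1–4) and
`…Theorems.SwirlFreeBudgetMeridional` (§5) for the frame.  hard core evaded: all eight — typed rungs and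
their monotonicity only; the with-swirl budget (`stmt-2002`) is NOT claimed.
-/

namespace Summit.NavierStokesRegularity.NavierStokesRegularity.Theorems.SwirlFreeBudget

open MeasureTheory Set Filter Topology Metric
open scoped ENNReal NNReal
open Literature.Analysis Literature.Analysis.FluidPDE
open Literature.Analysis.FluidPDE.SereginZajaczkowski2007

open Summit.NavierStokesRegularity.NavierStokesRegularity.Theorems.MeridionalBarrier
  (northwardMoment northwardDensity southwardDensity shellWindow northwardPeclet southwardPeclet
    meridionalPeclet)

noncomputable section
/-! ## 6. R19-PREP — the swirl-THRESHOLD budget (law N's `b - a > 0` rung), typed, with its ladder -/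

/-- **R19 target `SwirlThresholdBudget`** (memo §7 s18-3 (v); OPEN, theorem-candidate).  In the full
CKN gauge `M`, a swirl bound `|Γ| ≤ exp(-K(1+M)^K)` a.e. on `Q(z₀,1/4)` about an axis point — an
ARRHENIUS-small threshold, the size `δ_*^{1/2} c(M)^{1/τ}` of Lei–Zhang's Form-Boundedness constant
when `c(M)` is the constant of Chen–Tsai–Zhang's modulus `e^{-c|ln r|^τ}` (arXiv:2201.01766 Prop. 1.2)
— forces the POLYNOMIAL bound `|u| ≤ K(1+M)^K` a.e. on `Q(z₀,1/64)`.  Engine candidate: CTZ22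
Prop. 1.2 ⇒ `|Γ| ≲ |ln r|^{-2}` at unit scale ⇒ Lei–Zhang FBC (arXiv:1505.02628 Def. 1.1 / Thm 1.2,
`δ_*` universal) ⇒ a coupled `(Ω, J)` MOSER estimate started from `L^{1/2}` norms (crux K-19.1; the
`(Ω, J)` ENERGY method's start norm is not gauge-controlled), the localisation of Lei–Zhang's
theorem to the suitable class (K-19.2) and CTZ's `c(K,β,τ)` made explicit (K-19.3). -/
@[conjecture] def SwirlThresholdBudget : Prop :=
  ∃ K : ℝ, 0 < K ∧
    ∀ (u : ℝ → EuclideanSpace ℝ (Fin 3) → EuclideanSpace ℝ (Fin 3))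
      (p : ℝ → EuclideanSpace ℝ (Fin 3) → ℝ),
      IsSuitableWeakSolutionInBall 1 0 u p →
      (∀ t ∈ Ioo (-1 : ℝ) 0, IsAxisymmetric (u t)) →
      (∀ t ∈ Ioo (-1 : ℝ) 0, IsAxisymmetricScalar (p t)) →
      ∀ M : ℝ, 0 ≤ M → FullGauge M u p →
      ∀ z₀ ∈ parabolicCylinder (1 / 8) (0 : ℝ × EuclideanSpace ℝ (Fin 3)), cylRadius z₀.2 = 0 →
      (∀ᵐ z ∂(volume.restrict (parabolicCylinder (1 / 4) z₀)),
          |swirl (u z.1) z.2| ≤ Real.exp (-(K * (1 + M) ^ K))) →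
      ∀ᵐ z ∂(volume.restrict (parabolicCylinder (1 / 64) z₀)), ‖u z.1 z.2‖ ≤ K * (1 + M) ^ K

/-- **The POLYNOMIAL-threshold version** (memo §7 s18-3 (iv); conjecture — no engine is known: a
polynomially small swirl does not put `v^θ` in the Form-Boundedness class, the 2-D Hardy inequality at
the axis failing by a logarithm): threshold `(K(1+M)^K)⁻¹` instead of `exp(-K(1+M)^K)`. -/
@[conjecture] def SwirlThresholdPolynomialBound : Prop :=
  ∃ K : ℝ, 0 < K ∧
    ∀ (u : ℝ → EuclideanSpace ℝ (Fin 3) → EuclideanSpace ℝ (Fin 3))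
      (p : ℝ → EuclideanSpace ℝ (Fin 3) → ℝ),
      IsSuitableWeakSolutionInBall 1 0 u p →
      (∀ t ∈ Ioo (-1 : ℝ) 0, IsAxisymmetric (u t)) →
      (∀ t ∈ Ioo (-1 : ℝ) 0, IsAxisymmetricScalar (p t)) →
      ∀ M : ℝ, 0 ≤ M → FullGauge M u p →
      ∀ z₀ ∈ parabolicCylinder (1 / 8) (0 : ℝ × EuclideanSpace ℝ (Fin 3)), cylRadius z₀.2 = 0 →
      (∀ᵐ z ∂(volume.restrict (parabolicCylinder (1 / 4) z₀)),
          |swirl (u z.1) z.2| ≤ (K * (1 + M) ^ K)⁻¹) →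
      ∀ᵐ z ∂(volume.restrict (parabolicCylinder (1 / 64) z₀)), ‖u z.1 z.2‖ ≤ K * (1 + M) ^ K

/-- **LADDER, lower step (proved):** the threshold budget sits above R18's P₀ — a swirl-free solution
meets every threshold, so `SwirlThresholdBudget → SwirlFreePolynomialBound`. -/
theorem swirlFreePolynomialBound_of_thresholdBudget (h : SwirlThresholdBudget) :
    SwirlFreePolynomialBound := by
  obtain ⟨K, hK, hlaw⟩ := h
  refine ⟨K, hK, fun u p hsw hax haxp M hM hG z₀ hz₀ haxis hfree => ?_⟩
  refine hlaw u p hsw hax haxp M hM hG z₀ hz₀ haxis ?_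
  filter_upwards [hfree] with z hz
  rw [hz, abs_zero]
  exact (Real.exp_pos _).le

/-- **LADDER, upper step (proved):** the polynomial-threshold law is the STRONGER rung — it assumes
less swirl smallness — so `SwirlThresholdPolynomialBound → SwirlThresholdBudget` (same `K`). -/
theorem swirlThresholdBudget_of_polynomial (h : SwirlThresholdPolynomialBound) :
    SwirlThresholdBudget := by
  obtain ⟨K, hK, hlaw⟩ := h
  refine ⟨K, hK, fun u p hsw hax haxp M hM hG z₀ hz₀ haxis hsmall => ?_⟩
  refine hlaw u p hsw hax haxp M hM hG z₀ hz₀ haxis ?_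
  have hx : 0 < K * (1 + M) ^ K := mul_pos hK (Real.rpow_pos_of_pos (by linarith) K)
  -- `e^{-x} ≤ x⁻¹` for `x > 0` (an Arrhenius-small threshold is below the polynomial one; the companion's
  -- `exp_neg_le_inv`, inlined — it restates the tree's `Literature.Barriers.RiemannHypothesis.Hamburger1921.exp_neg_le_inv`)
  have hexp : Real.exp (-(K * (1 + M) ^ K)) ≤ (K * (1 + M) ^ K)⁻¹ := by
    rw [Real.exp_neg]
    exact inv_anti₀ hx (by linarith [Real.add_one_le_exp (K * (1 + M) ^ K)])
  filter_upwards [hsmall] with z hz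
  exact hz.trans hexp

/-- Hence the full ladder of ROUND-18/19 in the meridional frame: the polynomial-threshold law gives
the swirl-free budget law for every `κ₀ > 0` (through the Arrhenius rung and P₀). -/
theorem meridionalBudget_of_thresholdPolynomial (h : SwirlThresholdPolynomialBound) {κ₀ : ℝ}
    (hκ₀ : 0 < κ₀) : SwirlFreeBudget meridionalPeclet κ₀ :=
  meridionalBudget_of_polynomialBound
    (swirlFreePolynomialBound_of_thresholdBudget (swirlThresholdBudget_of_polynomial h)) hκ₀

end

end Summit.NavierStokesRegularity.NavierStokesRegularity.Theorems.SwirlFreeBudget
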